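import Summits.BirchSwinnertonDyer.BirchSwinnertonDyer.Theses.ResidualThetaTransportAtTwo
import Summits.BirchSwinnertonDyer.BirchSwinnertonDyer.Theorems.UniversalToricDescentLocalH1Corank
import Summits.BirchSwinnertonDyer.BirchSwinnertonDyer.Theorems.ResidualThetaTransportAtTwoResidualSignedLambdaLowerCMAtTwoCofreeTorsionFinite
import HarnessLib

/-!
# Sketch (stub-ideation k1 g15) — `stub_cmLambdaLower`: the F-E ENVELOPE at a good place `w ∤ 2M`
# (weakest sufficient form = `hS` + FIN read off the carrier; strongest provable form = the
# Frobenius PRESENTATION of the dual good block; T53 «never cyclic» VERIFIED and sharpened)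

Typed sketch for the idea card `stub-cmlambdalower-k1-g15` (crux item stmt-BirchSwinnertonDyer-26074,
stub `stub_cmLambdaLower` = route decl `ResidualSignedLambdaLowerCMAtTwo`, stmt-22608). Mathlib algebra
(§A, PROVED) + one typed signature over the tree's vocabulary (§B, a `Prop`, nothing asserted).

§A (PROVED):
* `le_finrank_baseChange_of_surjective` — PUSH-currency bridge by RIGHT EXACTNESS of `K ⊗_A –`:
  a surjection `P ↠ Q` onto a free module of rank `r` gives `r ≤ dim_K (K ⊗_A P)` (no flatness,
  no structure theorem).  This is the shape in which the S₀-count `hS : f·Σ ≤ dim_{ℚ₂}(ℚ₂ ⊗ P_S)` of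
  `ColemanSideInjective.finite_and_count_prodQuot` (p689690) is fed from ANY identification of a good
  block that merely SURJECTS onto `𝒪^{2}` per place `η` (Pontryagin dual of `A_ρ ↪ D_η`).
* `span_orbit_ne_top_of_forall_apply_eq_smul` / `exists_pair_linearIndependent_of_not_scalar` — T53
  VERIFIED AND SHARPENED to T53′ «cyclic iff `ρ̄(Frob_ℓ) ≠ 1`» (residual criterion, both directions): on a
  space of dimension `≥ 2`, a SCALAR endomorphism has no cyclic vector.  Applied to `ā(Frob) = 1̄`
  (`ρ̄(Frob_ℓ) = 1`, the Nakayama reduction of the dual good block `P_η ≅ (𝒪², Y ↦ B_η)`): the block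
  is NOT `≅ Λ_w/(𝒫_ℓ)` there, although it has the same characteristic ideal and the same `𝒪`-rank.
* `det_eq_trace_of_det_one_add_eq_one`, `mul_self_eq_zero_of_trace_eq_zero`,
  `isUnit_of_trace_ne_zero` — the UNIFORM presentation dichotomy in characteristic `2`: for
  `N̄ = M̄ − 1` with `det M̄ = 1`, `det N̄ = tr N̄ = tr M̄ = ā`; so `ā = 0 ⟹ N̄² = 0` (topologically
  nilpotent: the presentation `coker(T − N)` over `𝒪⟦T⟧` is `(𝒪², T ↦ N)`, rank 2 = `d_ℓ`) and
  `ā ≠ 0 ⟹ N̄` invertible (`T − N` is a unit of `M₂(𝒪⟦T⟧)`, the block is `0`).  No third case.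

§B (SIGNATURE ONLY): `LocalBlockIsCoefficientModuleAtEvenTracePlace` — the strongest provable LOCAL
statement the S₀-side ever needs, in iso form with the `𝒪`-action (`scalarH1` ↔ `•`), typed over
`subgroupH1 (kerD κ v) (Cofree ρ F)` exactly as `Sketch_sidea_k1_g11.lean` §B / `Sketch_sidea_k2_g8.lean` §B.

BSD is NOT proved by any of this; RSL_g (22608) and (R≥)ᵖ (26074) stay OPEN; nothing here is a tree
proposal, nothing is re-typed.
-/

set_option autoImplicit false
set_option linter.dupNamespace false

noncomputable section

open scoped Classical TensorProduct

namespace Summit.BirchSwinnertonDyer.BirchSwinnertonDyer.Cruxes.ResidualThetaCountLowerPureAtTwo.SideaK1G15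

/-! ## §A · proved algebra -/

section PushCurrency

variable {A : Type*} [CommRing A] [Nontrivial A] (K : Type*) [Field K] [Algebra A K]
  {P Q : Type*} [AddCommGroup P] [Module A P] [AddCommGroup Q] [Module A Q]

/-- **PUSH-currency bridge (right exactness).** A surjection `g : P ↠ Q` onto a free `A`-module of
finite rank gives `rank_A Q ≤ dim_K (K ⊗_A P)` whenever the right side is finite-dimensional
(`K ⊗_A –` preserves surjections; `dim_K (K ⊗_A Q) = rank_A Q` for `Q` free).  At the pins: `A = ℤ₂`,
`K = ℚ₂`, `P = P_w` the dual good block, `Q = 𝒪^{2·2^{n_ℓ}}` the Pontryagin dual of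
`⊕_{η∣w} A_ρ ↪ ⊕_η D_η` — this is ALL the S₀-count `hS` of `finite_and_count_prodQuot` consumes. -/
theorem le_finrank_baseChange_of_surjective (g : P →ₗ[A] Q) (hg : Function.Surjective g)
    [Module.Free A Q] [Module.Finite A Q] [Module.Finite K (K ⊗[A] P)] :
    Module.finrank A Q ≤ Module.finrank K (K ⊗[A] P) := by
  have hs : Function.Surjective (g.baseChange K) := by
    intro y
    obtain ⟨x, hx⟩ := LinearMap.lTensor_surjective K hg y
    exact ⟨x, by rw [← hx]; exact congrFun (LinearMap.baseChange_eq_ltensor (f := g) (A := K)) x⟩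
  calc Module.finrank A Q = Module.finrank K (K ⊗[A] Q) :=
        (Module.finrank_baseChange (R := K) (S := A) (M' := Q)).symm
    _ ≤ Module.finrank K (K ⊗[A] P) := LinearMap.finrank_le_finrank_of_surjective hs

end PushCurrency

section Cyclicity

variable {k : Type*} [Field k] {V : Type*} [AddCommGroup V] [Module k V]

/-- **T53 verified (residual criterion).** If `a` acts as a SCALAR on a space of dimension `≥ 2`, then
no vector is cyclic for `a`: the `k`-span of an orbit `{v, a v, a² v, …}` is the line `k ∙ v`.
Applied to the reduction mod `𝔪` of the dual good block `(𝒪², Y ↦ B_η)` at a place with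
`ρ̄(Frob_ℓ) = 1` (so `B̄_η = 1`): by Nakayama the block is not cyclic over `Λ_w = 𝒪⟦T⟧`, hence NOT
isomorphic to the Euler-factor module `Λ_w/(𝒫_ℓ(ℓ⁻¹γ_w))`, which is cyclic. -/
theorem span_orbit_ne_top_of_forall_apply_eq_smul [FiniteDimensional k V] (h2 : 2 ≤ Module.finrank k V)
    (a : Module.End k V) (c : k) (ha : ∀ v, a v = c • v) (v : V) :
    Submodule.span k (Set.range fun i : ℕ => (a ^ i) v) ≠ ⊤ := by
  have hmem : ∀ i : ℕ, (a ^ i) v ∈ Submodule.span k ({v} : Set V) := by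
    intro i
    induction i with
    | zero => simp [Submodule.mem_span_singleton_self v]
    | succ i ih =>
      rw [pow_succ', Module.End.mul_apply, ha]
      exact Submodule.smul_mem _ c ih
  intro htop
  have hle : Submodule.span k (Set.range fun i : ℕ => (a ^ i) v) ≤ Submodule.span k ({v} : Set V) :=
    Submodule.span_le.2 (Set.range_subset_iff.2 hmem)
  rw [htop, top_le_iff] at hle
  have h1 : Module.finrank k (Submodule.span k ({v} : Set V)) ≤ 1 := by
    simpa using finrank_span_le_card ({v} : Set V)
  rw [hle, finrank_top] at h1
  omega

/-- **… and nothing is lost where `ρ̄(Frob_ℓ) ≠ 1`** (residual criterion, hard direction): a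
NON-scalar `2 × 2` matrix over a field has a cyclic vector (`v`, `Mv` linearly independent), so by
Nakayama the dual good block `(𝒪², Y ↦ B_η)` IS cyclic — `≅ Λ_w/(det(Y − B_η))`, the Euler-factor
module — exactly at the places with `B̄_η` non-scalar, i.e. `ρ̄(Frob_ℓ) ≠ 1`.  Together with
`span_orbit_ne_top_of_forall_apply_eq_smul`: **T53′ — the cyclic form of F-E holds iff `ρ̄(Frob_ℓ) ≠ 1`.** -/
theorem exists_pair_linearIndependent_of_not_scalar {F : Type*} [Field F] (M : Matrix (Fin 2) (Fin 2) F)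
    (h : ¬ ∃ c : F, M = c • (1 : Matrix (Fin 2) (Fin 2) F)) :
    ∃ v : Fin 2 → F, LinearIndependent F ![v, M.mulVec v] := by
  by_cases h10 : M 1 0 ≠ 0
  · refine ⟨![1, 0], LinearIndependent.pair_iff.2 fun s t hst => ?_⟩
    have e0 := congrFun hst 0
    have e1 := congrFun hst 1
    simp at e0 e1
    rcases e1 with ht | hM
    · subst ht; simpa using e0
    · exact absurd hM h10
  by_cases h01 : M 0 1 ≠ 0
  · refine ⟨![0, 1], LinearIndependent.pair_iff.2 fun s t hst => ?_⟩
    have e0 := congrFun hst 0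
    have e1 := congrFun hst 1
    simp at e0 e1
    rcases e0 with ht | hM
    · subst ht; simpa using e1
    · exact absurd hM h01
  push Not at h10 h01
  have hne : M 0 0 ≠ M 1 1 := by
    intro heq
    apply h
    refine ⟨M 0 0, ?_⟩
    ext i j
    fin_cases i <;> fin_cases j <;> simp [h10, h01, heq]
  refine ⟨![1, 1], LinearIndependent.pair_iff.2 fun s t hst => ?_⟩
  have e0 := congrFun hst 0
  have e1 := congrFun hst 1
  simp [h10, h01] at e0 e1
  have ht : t * (M 0 0 - M 1 1) = 0 := by linear_combination e0 - e1
  rcases mul_eq_zero.1 ht with ht0 | hd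
  · subst ht0; constructor
    · simpa using e0
    · rfl
  · exact absurd (sub_eq_zero.1 hd) hne

end Cyclicity

section CharTwoDichotomy

variable {k : Type*} [CommRing k]

/-- In characteristic `2`: if `det (1 + N) = 1` for a `2 × 2` matrix `N` then **`det N = tr N`**
(`det(1+N) = 1 + tr N + det N`).  With `N̄ = M̄ − 1`, `M̄ = ρ̄(Frob_ℓ)`, `det M̄ = ℓ̄ = 1`: `det N̄ = tr N̄ = ā`. -/
theorem det_eq_trace_of_det_one_add_eq_one (h2 : (2 : k) = 0) (N : Matrix (Fin 2) (Fin 2) k)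
    (h : (1 + N).det = 1) : N.det = N.trace := by
  have h' : (1 + N 0 0) * (1 + N 1 1) - N 0 1 * N 1 0 = 1 := by
    simpa [Matrix.det_fin_two, Matrix.add_apply, Matrix.one_apply] using h
  rw [Matrix.det_fin_two, Matrix.trace_fin_two]
  linear_combination h' - (N 0 0 + N 1 1) * h2

/-- **Even trace ⟹ `N̄² = 0`** (`tr N̄ = 0`, hence `det N̄ = 0`, Cayley–Hamilton): `N̄` is nilpotent,
`N` is topologically nilpotent on `𝒪²`, and the Frobenius presentation `coker(T − N)` over `𝒪⟦T⟧` is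
the coefficient lattice `(𝒪², T ↦ N)` of rank `2 = d_ℓ`. -/
theorem mul_self_eq_zero_of_trace_eq_zero (h2 : (2 : k) = 0) (N : Matrix (Fin 2) (Fin 2) k)
    (h : (1 + N).det = 1) (htr : N.trace = 0) : N * N = 0 := by
  have hd : N 0 0 * N 1 1 - N 0 1 * N 1 0 = 0 := by
    rw [← Matrix.det_fin_two, det_eq_trace_of_det_one_add_eq_one h2 N h, htr]
  have ht : N 0 0 + N 1 1 = 0 := by rwa [Matrix.trace_fin_two] at htr
  ext i j
  fin_cases i <;> fin_cases j <;>
    simp only [Matrix.mul_apply, Fin.sum_univ_two, Matrix.zero_apply, Fin.zero_eta, Fin.mk_one, Fin.isValue]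
  · linear_combination (N 0 0) * ht - hd
  · linear_combination (N 0 1) * ht
  · linear_combination (N 1 0) * ht
  · linear_combination (N 1 1) * ht - hd

/-- **Odd trace ⟹ `N̄` invertible** (`det N̄ = tr N̄ ≠ 0` over a field): `T − N` is a unit of
`M₂(𝒪⟦T⟧)` and the Frobenius presentation is `0` — the block vanishes (k1-g11 (T0)), no third case. -/
theorem isUnit_of_trace_ne_zero {F : Type*} [Field F] (h2 : (2 : F) = 0) (N : Matrix (Fin 2) (Fin 2) F)
    (h : (1 + N).det = 1) (htr : N.trace ≠ 0) : IsUnit N := by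
  rw [Matrix.isUnit_iff_isUnit_det, det_eq_trace_of_det_one_add_eq_one h2 N h]
  exact isUnit_iff_ne_zero.2 htr

end CharTwoDichotomy

/-! ## §B · typed signature (Prop only; nothing asserted) -/

section Signatures

open Literature.NumberTheory.EllipticCurves Literature.NumberTheory.EllipticCurves.GreenbergSelmer
open Literature.NumberTheory.GaloisRepresentations NumberField IsDedekindDomain Field
open Rat.HeightOneSpectrum
open Summit.BirchSwinnertonDyer.Rank1Residual.X11b.Coinv (kerD)

/-- **The good block IS the coefficient module, as an `𝒪`-module (signature; strongest provable LOCAL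
form at an even-trace place).** For the cyclotomic `ℤ₂`-extension `κ` of `ℚ`, `ρ : Γ_ℚ → GL₂(𝒪)`
unramified at `v ∤ 2` with Frobenius characteristic polynomial `X² − aX + ℓ`, `‖a‖ < 1`: there is an
additive isomorphism `D_w = H¹(Gal(ℚ̄_ℓ/ℚ_{∞,η}), A_ρ) ≃ A_ρ` carrying the cohomological scalars
`scalarH1 c` to `c • ·` (evaluation at a tame generator; inverse = the tame Kummer section, k4-g10 `t`,
k1-g11 (T2)).  Its Pontryagin dual is `P_η ≅ 𝒪²` with `γ_w` acting by a twist `B_η` of the framed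
Frobenius: COUNT and FIN of S1⊕ are read off the carrier; the Euler factor is `det(Y − B_η)` and is
consumed by nobody. -/
def LocalBlockIsCoefficientModuleAtEvenTracePlace : Prop :=
  ∀ (S : Set (PadicAlgCl 2)) [FiniteDimensional ℚ_[2] ↥(padicCoeffField S)]
    (κ : ZpExtension ℚ 2), κ.IsCyclotomic →
  ∀ (ρ : FramedGaloisRep ℚ ↥(padicCoeffIntegers S) 2) (v : HeightOneSpectrum (𝓞 ℚ)),
    ((2 : ℕ) : 𝓞 ℚ) ∉ v.asIdeal → ρ.IsUnramifiedAt v →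
    (∃ (a : PadicAlgCl 2) (P : Polynomial ↥(padicCoeffIntegers S)), ‖a‖ < 1 ∧
        P.map (padicCoeffIntegers S).subtype =
          Polynomial.X ^ 2 - Polynomial.C a * Polynomial.X + Polynomial.C ((natGenerator v : ℕ) : PadicAlgCl 2) ∧
        ρ.HasFrobCharpolyAt v P) →
    ∃ e : subgroupH1 (kerD κ v) (Cofree ρ ↥(padicCoeffField S)) ≃+ Cofree ρ ↥(padicCoeffField S),
      ∀ (c : ↥(padicCoeffIntegers S)) (y : subgroupH1 (kerD κ v) (Cofree ρ ↥(padicCoeffField S))),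
        e (scalarH1 (kerD κ v) (Cofree ρ ↥(padicCoeffField S)) c y) = c • e y

end Signatures

end Summit.BirchSwinnertonDyer.BirchSwinnertonDyer.Cruxes.ResidualThetaCountLowerPureAtTwo.SideaK1G15

end
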